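import Summits.Ventures.PercRepro.Night2LocalD2R14LargeCount

/-!
# PercRepro — the large shadow sets of the coloop cell: covering preimages against pair preimages (night-2, gen 16)

At a shadow set `S` with `|S| ≥ 7` of the coloop cell (simple matroid), a covering preimage with `|G ∖ cl B| ≥ 2` is
`S ∖ {z}` for a coloop `z ≠ y` of `S` (`exists_coloop_of_mem_r14CovPre`), and such a `z` lies in no pair set
(`notMem_sdiff_of_mem_pairPre_of_coloop`).  Hence (proofs/NIGHT-2-k1.md §6 (C1), (C2)):

* **`card_pairPre_le_two_of_covPre`**: one such covering preimage leaves at most two pair preimages — the sets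
  `B ∖ {y, z}` of two pair preimages have rank `2` and meet in at most one point, which forces `|S| ≤ 7` and
  `T₁ ∪ T₂ = S ∖ {y, z}`; a third one would meet one of them in two points;
* **`pairPre_eq_empty_of_two_covPre`**: two such covering preimages leave none — `B ∖ {y, z₁, z₂}` has rank `1`, so
  `|B| ≤ 4` and `|S| ≤ 6`.
-/

namespace PercRepro.Shadow

open Finset PerFlat ThmH

variable {α : Type*} [DecidableEq α] {M : Matroid α} [M.Finite]

/-! ## Covering preimages and pair preimages -/

open scoped Classical in
/-- A covering preimage with `|G ∖ cl B| ≥ 2` is `S ∖ {z}` for a coloop `z ≠ y` of `S`, and contains `y`. -/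
theorem exists_coloop_of_mem_r14CovPre {G : Finset α} (hG : G ∈ flatsQ M (4 + 1)) {y : α} (hyG : y ∈ G)
    (hyc : y ∉ clF M (G.erase y)) {S B : Finset α} (hB : B ∈ r14CovPre M G S) :
    ∃ z ∈ S, z ≠ y ∧ B = S.erase z ∧ z ∉ clF M (S.erase z) ∧ y ∈ B := by
  unfold r14CovPre at hB
  rw [Finset.mem_filter, mem_coverPreimages] at hB
  obtain ⟨⟨hBm, hcov⟩, hm⟩ := hB
  obtain ⟨z, hz, rfl⟩ := mem_coverSets.1 hcov
  have hU : B ∈ Uq M (4 + 2) 4 := (mem_membersIn.1 hBm).1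
  have hzB : z ∉ B := fun h => (Finset.mem_sdiff.1 hz).2 (subset_clF hU h)
  have hm2 : 2 ≤ (G \ clF M B).card := by
    have : 0 < (G \ clF M B).card := Finset.card_pos.2 ⟨z, hz⟩
    omega
  have hyB := mem_of_two_le_card_sdiff_clF hG hyG hyc hBm hm2
  refine ⟨z, Finset.mem_insert_self _ _, fun h => hzB (h ▸ hyB), (Finset.erase_insert hzB).symm, ?_, hyB⟩
  rw [Finset.erase_insert hzB]
  exact (Finset.mem_sdiff.1 hz).2

open scoped Classical in
/-- The shadow set of a pair preimage lies in `G`. -/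
theorem subset_of_mem_pairPre' {q : ℕ} {G S B : Finset α} (hB : B ∈ pairPre M q G S) : S ⊆ G := by
  obtain ⟨hBm, P, hP, rfl⟩ := mem_pairPre.1 hB
  rw [Finset.mem_powersetCard] at hP
  have hU : B ∈ Uq M (q + 2) q := (mem_membersIn.1 hBm).1
  exact Finset.union_subset ((subset_clF hU).trans (mem_membersIn.1 hBm).2)
    (fun e he => (Finset.mem_sdiff.1 (hP.1 he)).1)

open scoped Classical in
/-- A coloop `z` of `S` whose face `S ∖ {z}` is a member lies in no pair set. -/
theorem notMem_sdiff_of_mem_pairPre_of_coloop {G : Finset α} (hG : G ∈ flatsQ M (4 + 1)) {S : Finset α}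
    {z : α} (hz : S.erase z ∈ membersIn M (Uq M (4 + 2) 4) G) {B : Finset α}
    (hB : B ∈ pairPre M 4 G S) : z ∉ S \ B := by
  intro hzX
  have hGg : G ⊆ gr M := (mem_flatsQ.1 hG).1
  have hBm := (mem_pairPre.1 hB).1
  have hU : B ∈ Uq M (4 + 2) 4 := (mem_membersIn.1 hBm).1
  have hUz : S.erase z ∈ Uq M (4 + 2) 4 := (mem_membersIn.1 hz).1
  have hBz : B ⊆ S.erase z := by
    intro e he
    rw [Finset.mem_erase]
    exact ⟨fun h => (Finset.mem_sdiff.1 hzX).2 (h ▸ he), subset_of_mem_pairPre hB he⟩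
  have hSg : S.erase z ⊆ gr M := (Finset.erase_subset _ _).trans ((subset_of_mem_pairPre' hB).trans hGg)
  have hreq : rkN M B = rkN M (S.erase z) := by
    rw [rkN_eq_of_mem_Uq hU, rkN_eq_of_mem_Uq hUz]
  have hcl := subset_closure_of_rkN_eq (M := M) hSg hBz hreq
  -- the other point `w` of the pair set lies in `cl B`
  have hc := card_sdiff_of_mem_pairPre hB
  obtain ⟨x, w, hxw, hxy⟩ := Finset.card_eq_two.1 hc
  have hw : ∃ w ∈ S \ B, w ≠ z := by
    rw [hxy] at hzX ⊢
    simp only [Finset.mem_insert, Finset.mem_singleton] at hzX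
    rcases hzX with rfl | rfl
    · exact ⟨w, by simp, fun h => hxw h.symm⟩
    · exact ⟨x, by simp, hxw⟩
  obtain ⟨w, hwX, hwz⟩ := hw
  have hwS : w ∈ S.erase z := Finset.mem_erase.2 ⟨hwz, (Finset.mem_sdiff.1 hwX).1⟩
  have hwcl : w ∈ clF M B := by
    rw [mem_clF_iff]
    exact hcl (Finset.mem_coe.2 hwS)
  exact (Finset.mem_sdiff.1 (sdiff_subset_of_mem_pairPre hB hwX)).2 hwcl

/-- Inserting a coloop `z` of `S` into a subset of `S ∖ {z}` raises the rank by one. -/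
theorem rkN_insert_coloop_eq {S : Finset α} (hSg : S ⊆ gr M) {z : α} (hzS : z ∈ S) (hz : z ∉ clF M (S.erase z))
    {X : Finset α} (hX : X ⊆ S.erase z) : rkN M (insert z X) = rkN M X + 1 :=
  rkN_insert_eq_add_one_of_notMem_clF (hX.trans ((Finset.erase_subset _ _).trans hSg)) (hSg hzS)
    (fun h => hz (clF_mono hX h))

/-- A set containing `y` and `z` is `insert y (insert z (B ∖ {y, z}))`. -/
theorem eq_insert_insert_sdiff {B : Finset α} {y z : α} (hy : y ∈ B) (hz : z ∈ B) :
    B = insert y (insert z (B \ {y, z})) := by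
  ext e
  simp only [Finset.mem_insert, Finset.mem_sdiff, Finset.mem_singleton]
  constructor
  · intro he
    by_cases hey : e = y
    · exact Or.inl hey
    · by_cases hez : e = z
      · exact Or.inr (Or.inl hez)
      · exact Or.inr (Or.inr ⟨he, by tauto⟩)
  · rintro (rfl | rfl | ⟨he, -⟩)
    · exact hy
    · exact hz
    · exact he

open scoped Classical in
/-- The rank of `B ∖ {y, z}` is `ρ(B) − 2` when `y` is the coloop of `M|G` and `z` a coloop of `S ⊆ G`, `y ≠ z`,
both in `B ⊆ S`. -/
theorem rkN_sdiff_pair_add_two {G : Finset α} (hGg : G ⊆ gr M) {y : α} (hyG : y ∈ G)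
    (hyc : y ∉ clF M (G.erase y)) {S : Finset α} (hSG : S ⊆ G) {z : α} (hzS : z ∈ S)
    (hz : z ∉ clF M (S.erase z)) (hyz : y ≠ z) {B : Finset α} (hBS : B ⊆ S) (hyB : y ∈ B) (hzB : z ∈ B) :
    rkN M (B \ {y, z}) + 2 = rkN M B := by
  have hT : B \ {y, z} ⊆ S.erase z := by
    intro e he
    rw [Finset.mem_sdiff, Finset.mem_insert, Finset.mem_singleton, not_or] at he
    exact Finset.mem_erase.2 ⟨he.2.2, hBS he.1⟩
  have h1 := rkN_insert_coloop_eq (hSG.trans hGg) hzS hz hT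
  have hT' : insert z (B \ {y, z}) ⊆ G.erase y := by
    intro e he
    rw [Finset.mem_insert] at he
    rw [Finset.mem_erase]
    rcases he with rfl | he
    · exact ⟨hyz.symm, hSG hzS⟩
    · rw [Finset.mem_sdiff, Finset.mem_insert, Finset.mem_singleton, not_or] at he
      exact ⟨he.2.1, hSG (hBS he.1)⟩
  have h2 := rkN_insert_coloop_eq hGg hyG hyc hT'
  rw [← eq_insert_insert_sdiff hyB hzB] at h2
  omega

open scoped Classical in
/-- **Two covering preimages with `|G ∖ cl B| ≥ 2` leave no pair preimage** at `|S| ≥ 7` (simple matroid). -/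
theorem pairPre_eq_empty_of_two_covPre {G : Finset α} (hG : G ∈ flatsQ M (4 + 1))
    (hsimple : ∀ e ∈ gr M, ∀ f ∈ gr M, e ≠ f → rkN M {e, f} = 2) {y : α} (hyG : y ∈ G)
    (hyc : y ∉ clF M (G.erase y)) {S : Finset α} (hS : S ∈ shadowAt M (4 + 2) 4 (Uq M (4 + 2) 4) G)
    (h7 : 7 ≤ S.card) {B₁ B₂ : Finset α} (h₁ : B₁ ∈ r14CovPre M G S) (h₂ : B₂ ∈ r14CovPre M G S)
    (hne : B₁ ≠ B₂) : pairPre M 4 G S = ∅ := by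
  have hGg : G ⊆ gr M := (mem_flatsQ.1 hG).1
  have hSG : S ⊆ G := subset_of_mem_shadowAt hS
  obtain ⟨z₁, hz₁S, hz₁y, rfl, hz₁, -⟩ := exists_coloop_of_mem_r14CovPre hG hyG hyc h₁
  obtain ⟨z₂, hz₂S, hz₂y, rfl, hz₂, -⟩ := exists_coloop_of_mem_r14CovPre hG hyG hyc h₂
  have hz₁₂ : z₁ ≠ z₂ := fun h => hne (by rw [h])
  have hm₁ : S.erase z₁ ∈ membersIn M (Uq M (4 + 2) 4) G := by
    unfold r14CovPre at h₁
    exact (mem_coverPreimages.1 (Finset.mem_filter.1 h₁).1).1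
  have hm₂ : S.erase z₂ ∈ membersIn M (Uq M (4 + 2) 4) G := by
    unfold r14CovPre at h₂
    exact (mem_coverPreimages.1 (Finset.mem_filter.1 h₂).1).1
  rw [Finset.eq_empty_iff_forall_notMem]
  intro B hB
  have hU : B ∈ Uq M (4 + 2) 4 := (mem_membersIn.1 (mem_pairPre.1 hB).1).1
  have hBS := subset_of_mem_pairPre hB
  have hyB := mem_of_mem_pairPre hG hyG hyc hB
  have hz₁B : z₁ ∈ B := by
    have := notMem_sdiff_of_mem_pairPre_of_coloop hG hm₁ hB
    by_contra h
    exact this (Finset.mem_sdiff.2 ⟨hz₁S, h⟩)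
  have hz₂B : z₂ ∈ B := by
    have := notMem_sdiff_of_mem_pairPre_of_coloop hG hm₂ hB
    by_contra h
    exact this (Finset.mem_sdiff.2 ⟨hz₂S, h⟩)
  -- `T = B ∖ {y, z₁, z₂}` has rank `1`
  set T := (B \ {y, z₁}) \ {z₂} with hTdef
  have hT : T ⊆ S.erase z₂ := by
    intro e he
    rw [hTdef, Finset.mem_sdiff, Finset.mem_sdiff, Finset.mem_singleton] at he
    exact Finset.mem_erase.2 ⟨he.2, hBS he.1.1⟩
  have h1 := rkN_insert_coloop_eq (hSG.trans hGg) hz₂S hz₂ hT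
  have hins : insert z₂ T = B \ {y, z₁} := by
    rw [hTdef, Finset.sdiff_singleton_eq_erase, Finset.insert_erase]
    rw [Finset.mem_sdiff, Finset.mem_insert, Finset.mem_singleton, not_or]
    exact ⟨hz₂B, fun h => hz₂y h, fun h => hz₁₂ h.symm⟩
  rw [hins] at h1
  have h2 := rkN_sdiff_pair_add_two hGg hyG hyc hSG hz₁S hz₁ hz₁y.symm hBS hyB hz₁B
  have h3 := rkN_eq_of_mem_Uq hU
  have hT1 : rkN M T ≤ 1 := by omega
  have hTc : T.card ≤ 1 :=
    card_le_one_of_rkN_le_one hsimple ((hT.trans (Finset.erase_subset _ _)).trans (hSG.trans hGg)) hT1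
  -- so `|B| ≤ 4` and `|S| ≤ 6`
  have hBc : B.card ≤ 4 := by
    have e1 : B ⊆ insert y (insert z₁ (insert z₂ T)) := by
      intro e he
      simp only [hTdef, Finset.mem_insert, Finset.mem_sdiff, Finset.mem_singleton, not_or]
      by_cases hey : e = y
      · exact Or.inl hey
      by_cases hez₁ : e = z₁
      · exact Or.inr (Or.inl hez₁)
      by_cases hez₂ : e = z₂
      · exact Or.inr (Or.inr (Or.inl hez₂))
      exact Or.inr (Or.inr (Or.inr ⟨⟨he, hey, hez₁⟩, hez₂⟩))
    have := Finset.card_le_card e1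
    have := Finset.card_insert_le y (insert z₁ (insert z₂ T))
    have := Finset.card_insert_le z₁ (insert z₂ T)
    have := Finset.card_insert_le z₂ T
    omega
  have hSc := Finset.card_sdiff_add_card_eq_card hBS
  have hX := card_sdiff_of_mem_pairPre hB
  omega

open scoped Classical in
/-- **A covering preimage with `|G ∖ cl B| ≥ 2` leaves at most two pair preimages** at `|S| ≥ 7` (simple). -/
theorem card_pairPre_le_two_of_covPre {G : Finset α} (hG : G ∈ flatsQ M (4 + 1))
    (hsimple : ∀ e ∈ gr M, ∀ f ∈ gr M, e ≠ f → rkN M {e, f} = 2) {y : α} (hyG : y ∈ G)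
    (hyc : y ∉ clF M (G.erase y)) {S : Finset α} (hS : S ∈ shadowAt M (4 + 2) 4 (Uq M (4 + 2) 4) G)
    (h7 : 7 ≤ S.card) {B₁ : Finset α} (h₁ : B₁ ∈ r14CovPre M G S) : (pairPre M 4 G S).card ≤ 2 := by
  have hGg : G ⊆ gr M := (mem_flatsQ.1 hG).1
  have hSG : S ⊆ G := subset_of_mem_shadowAt hS
  obtain ⟨z, hzS, hzy, rfl, hz, -⟩ := exists_coloop_of_mem_r14CovPre hG hyG hyc h₁
  have hm : S.erase z ∈ membersIn M (Uq M (4 + 2) 4) G := by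
    unfold r14CovPre at h₁
    exact (mem_coverPreimages.1 (Finset.mem_filter.1 h₁).1).1
  -- the facts about one pair preimage
  have hfacts : ∀ B ∈ pairPre M 4 G S, y ∈ B ∧ z ∈ B ∧ rkN M (B \ {y, z}) = 2 ∧ (B \ {y, z}).card + 4 = S.card ∧
      B \ {y, z} ⊆ S \ {y, z} := by
    intro B hB
    have hU : B ∈ Uq M (4 + 2) 4 := (mem_membersIn.1 (mem_pairPre.1 hB).1).1
    have hBS := subset_of_mem_pairPre hB
    have hyB := mem_of_mem_pairPre hG hyG hyc hB
    have hzB : z ∈ B := by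
      have := notMem_sdiff_of_mem_pairPre_of_coloop hG hm hB
      by_contra h
      exact this (Finset.mem_sdiff.2 ⟨hzS, h⟩)
    have h2 := rkN_sdiff_pair_add_two hGg hyG hyc hSG hzS hz hzy.symm hBS hyB hzB
    have h3 := rkN_eq_of_mem_Uq hU
    have hc : (B \ {y, z}).card + 2 = B.card := by
      have := Finset.card_sdiff_add_card_eq_card (show ({y, z} : Finset α) ⊆ B from
        Finset.insert_subset hyB (Finset.singleton_subset_iff.2 hzB))
      rw [Finset.card_pair hzy.symm] at this
      omega
    have hSc := Finset.card_sdiff_add_card_eq_card hBS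
    have hX := card_sdiff_of_mem_pairPre hB
    refine ⟨hyB, hzB, by omega, by omega, Finset.sdiff_subset_sdiff hBS (le_refl _)⟩
  -- two distinct pair preimages: `ρ(T ∪ T') ≥ 3`, hence `|T ∩ T'| ≤ 1`
  have hpair : ∀ B ∈ pairPre M 4 G S, ∀ B' ∈ pairPre M 4 G S, B ≠ B' →
      ((B \ {y, z}) ∩ (B' \ {y, z})).card ≤ 1 := by
    intro B hB B' hB' hne
    obtain ⟨hyB, hzB, hr, -, -⟩ := hfacts B hB
    obtain ⟨hyB', hzB', hr', -, -⟩ := hfacts B' hB'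
    have hU : B ∈ Uq M (4 + 2) 4 := (mem_membersIn.1 (mem_pairPre.1 hB).1).1
    have hUn : 5 ≤ rkN M (B ∪ B') := by
      have hXne := sdiff_ne_of_mem_pairPre hB hB' hne
      obtain ⟨e, he₁, he₂⟩ : ∃ e ∈ S \ B, e ∉ S \ B' := by
        by_contra hcon
        push Not at hcon
        apply hXne
        apply Finset.eq_of_subset_of_card_le hcon
        rw [card_sdiff_of_mem_pairPre hB, card_sdiff_of_mem_pairPre hB']
      have heB' : e ∈ B' := by
        by_contra h
        exact he₂ (Finset.mem_sdiff.2 ⟨(Finset.mem_sdiff.1 he₁).1, h⟩)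
      have h1 := rkN_insert_eq_of_mem_sdiff_clF hG hU (sdiff_subset_of_mem_pairPre hB he₁)
      have h2 : insert e B ⊆ B ∪ B' := Finset.insert_subset (Finset.mem_union_right _ heB') Finset.subset_union_left
      have := rkN_mono (M := M) h2
      omega
    have hsplit := rkN_sdiff_pair_add_two hGg hyG hyc hSG hzS hz hzy.symm (Finset.union_subset
      (subset_of_mem_pairPre hB) (subset_of_mem_pairPre hB')) (Finset.mem_union_left _ hyB) (Finset.mem_union_left _ hzB)
    rw [Finset.union_sdiff_distrib] at hsplit
    have hsub := rkN_submod (M := M) (B \ {y, z}) (B' \ {y, z})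
    have hI : rkN M ((B \ {y, z}) ∩ (B' \ {y, z})) ≤ 1 := by omega
    exact card_le_one_of_rkN_le_one hsimple
      (Finset.inter_subset_left.trans (Finset.sdiff_subset.trans ((subset_of_mem_pairPre hB).trans (hSG.trans hGg)))) hI
  by_contra hcon
  push Not at hcon
  rw [Finset.two_lt_card_iff] at hcon
  obtain ⟨B₁, B₂, B₃, hB₁, hB₂, hB₃, h₁₂, h₁₃, h₂₃⟩ := hcon
  obtain ⟨-, -, -, hc₁, hW₁⟩ := hfacts B₁ hB₁
  obtain ⟨-, -, -, hc₂, hW₂⟩ := hfacts B₂ hB₂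
  obtain ⟨-, -, -, hc₃, hW₃⟩ := hfacts B₃ hB₃
  have hi₁₂ := hpair B₁ hB₁ B₂ hB₂ h₁₂
  have hi₁₃ := hpair B₁ hB₁ B₃ hB₃ h₁₃
  have hi₂₃ := hpair B₂ hB₂ B₃ hB₃ h₂₃
  -- `|S ∖ {y, z}| = |S| − 2`
  have hyS : y ∈ S := mem_of_mem_shadowAt_of_coloop (by rw [rkN_erase_eq_of_coloop hG hyG hyc]) hS
  have hW : (S \ {y, z}).card + 2 = S.card := by
    have := Finset.card_sdiff_add_card_eq_card (show ({y, z} : Finset α) ⊆ S from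
      Finset.insert_subset hyS (Finset.singleton_subset_iff.2 hzS))
    rw [Finset.card_pair hzy.symm] at this
    omega
  have hu₁₂ := Finset.card_union_add_card_inter (B₁ \ {y, z}) (B₂ \ {y, z})
  have hle₁₂ := Finset.card_le_card (Finset.union_subset hW₁ hW₂)
  -- hence `|S| = 7` and `T₁ ∪ T₂ = S ∖ {y, z}`
  have hS7 : S.card = 7 := by omega
  have hunion : (B₁ \ {y, z}) ∪ (B₂ \ {y, z}) = S \ {y, z} :=
    Finset.eq_of_subset_of_card_le (Finset.union_subset hW₁ hW₂) (by omega)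
  have hT₃ : B₃ \ {y, z} ⊆ ((B₃ \ {y, z}) ∩ (B₁ \ {y, z})) ∪ ((B₃ \ {y, z}) ∩ (B₂ \ {y, z})) := by
    intro e he
    have : e ∈ (B₁ \ {y, z}) ∪ (B₂ \ {y, z}) := by rw [hunion]; exact hW₃ he
    rw [Finset.mem_union] at this ⊢
    rw [Finset.mem_inter, Finset.mem_inter]
    tauto
  have := Finset.card_le_card hT₃
  have := Finset.card_union_le ((B₃ \ {y, z}) ∩ (B₁ \ {y, z})) ((B₃ \ {y, z}) ∩ (B₂ \ {y, z}))
  rw [Finset.inter_comm] at hi₁₃ hi₂₃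
  omega

end PercRepro.Shadow
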